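import Summits.BirchSwinnertonDyer.Rank1Residual.GaloisImage.UnramifiedOrthogonalOfIsPerfect
import Literature.NumberTheory.GaloisCohomology.PairingTateDual
import Literature.NumberTheory.GaloisRepresentations.ContinuousH1OrderTwo
import Literature.NumberTheory.GaloisRepresentations.LocalGlobalCohomologyDualityProofs
import Literature.NumberTheory.EllipticCurves.KummerSelmerStructure
import HarnessLib

/-!
# K6 crux `MuTransferX9` (stmt-BirchSwinnertonDyer-19276), MU-TRANSFER-PROOF §5 STEP 4
# (reciprocity): the Poitou–Tate local term AT THE AUXILIARY PRIME `q` VANISHES for a pair of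
# global classes unramified outside `S ∪ {q}` whose local terms vanish on `S` — at every ODD level
# `n` (so at `p = 3` as well as `p ≥ 5`), for EVERY family of local invariant maps satisfying the
# Poitou–Tate vanishing, and for EVERY equivariant `μₙ`-valued pairing

Cell `b2b-bsdres`, unit `b2b-bsdres-x10` (N2 = X10b at `p = 3` class lead, GEN 38), serving the cell
`bsd-smallim` (route `SmallImageMuTransfer`, rung K6, deciding crux 19276 `MuTransferX9`, skeleton v4
sha16 0154dd5daf38efd6, open stub `stub_coreX9`, cut by the assembler `bsd-smallim-k6-c2` g3 into G1
Selmer side / G2 Chebotarev coset / G3 Kolyvagin class / G4 STEP 4 — THIS FILE is the generic half of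
G4). HONEST FRAMING: TOOL theorems of global Galois cohomology; no definition, no named fact, no
`sorry`; nothing is asserted about any curve, nothing is booked; X9 stays TYPED at class level, X10b
(N2) keeps its label CONSTRUCTION-SHAPED / NEEDS X_A3. `--supports stmt-BirchSwinnertonDyer-19276`
(helper; closes nothing). PARTITION (D-0054): X9 (A4) × `p ∈ {5, 7}` · X10b (A5) × `p = 3`.

## The step (MU-TRANSFER-PROOF §5 STEP 4, HOME pub/bsd-smallim/koly/MU-TRANSFER-PROOF.md)

«`Σ_v inv_v(T^ε κ_q ∪ y) = 0` (`v = ∞`: nothing, `p` odd). For `v ∈ S`: `inv_v(…) = 0` (STEP 1). For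
`v ∉ S ∪ {q}`: both classes unramified, `inv_v = 0`. Hence `0 = inv_q(T^ε κ_q ∪ y)`.» This file
proves that bookkeeping ONCE, for any number field `K`, any finite discrete `Γ_K`-module `M` killed
by an ODD `n`, any family `inv : LocalInvariants K n` with the Poitou–Tate vanishing
`inv.SumLocalTermEqZero` (= the content of the tree's named fact `poitouTate_sum_localTatePairing_eq_zero K`,
consumed as a HYPOTHESIS as in the tree's Cassels–Tate files — no fact is introduced or restated),
a finite set `S` of finite places and one finite place `q`:

* §1 the three local vanishings — at an INFINITE place the local term of ANY pair vanishes because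
  `H¹(K_w, M)` is killed by `2` and by the odd `n` (tree `eq_zero_of_odd_nsmul_galoisCohomology_one_toLocal_inl`,
  `galoisCohomology.nsmul_eq_zero_of_forall`: `localTerm_inl_eq_zero_of_odd`) — THIS is the memo's
  «`v = ∞`: nothing, `p` odd», the one place of STEP 4 where `p ≠ 2` is used; at a FINITE place where
  inertia fixes `M` and `M^D` two unramified localisations pair to zero for EVERY additive `inv_v`
  (cell `b2b-bsdres` team n1011's `UnramifiedCup.localTatePairingZMod_eq_zero_of_mem_unramifiedSubgroup`,
  Milne I Thm. 2.6: `localTerm_inr_eq_zero_of_mem_unramifiedSubgroup`); and a term with a vanishing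
  localisation on either side vanishes (`localTerm_eq_zero_of_localization_{left,right}_eq_zero`);
* §2 **`localTerm_inr_eq_zero_of_unramified_outside`**: if `loc_v x`, `loc_v y` are unramified at every
  finite `v ∉ S`, `v ≠ q` at which inertia fixes `M` and `M^D`, and the local terms vanish on `S`, then
  THE LOCAL TERM AT `q` VANISHES (`SumLocalTermEqZero.localTerm_eq_zero`: no single place carries a
  non-zero term); the variant `…_of_isUnramifiedAt` reads the inertia hypotheses from
  `GaloisRep.IsUnramifiedAt v ρ` and `v ∤ n` (`UnramifiedCup.toLocal_tateDual_apply_of_mem_absInertia_of_not_mem`);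
* §3 the same for an arbitrary equivariant pairing `B : M₁ × M₂ → μₙ` (tree `DiscreteGaloisModule.pairing`,
  `pairingDualIntertwining`): **`localTerm_pairingDual_eq_zero_of_unramified_outside`** — the term at `q`
  of `(x, (B^♭)_* y)` vanishes — with `y ∈ H¹(K, M₂)` unramified off `S ∪ {q}` (equivariant maps preserve
  unramified classes, `localization_map_mem_unramifiedSubgroup`) and `loc_v y = 0` on `S` (the shape
  STEP 1 / G1 delivers: `T^ε·loc_v y = 0`, i.e. `loc_v (T^ε y) = 0`), and its FAMILY form
  `localTerm_map_pairingDual_eq_zero_of_unramified_outside`: the same for `(φ_* x, y)` for EVERY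
  `Γ_K`-equivariant endomorphism `φ` of `M₁` — with `φ = S^{J−1−k}` on `𝒯_J` these are the members
  `Φ_k(κ_q, T^ε ψ) = inv_q(S^{J−1−k}_* κ_q ∪ T^ε ψ)` of `bsd-smallim-koly`'s coefficient family
  (STATUS 12:17Z assembly recipe; `…X9PairingUniqueness`, `…X9LocalSplitNaturality`), whose vanishing
  turns Lemma 1 (iii) (`u(T)·⟨·,·⟩_{A_J}`) into «every coefficient of `U·T^{ε+e+a}·⟨k₁, c_y(Fr_q)⟩_{A_J}`
  vanishes» = the hypothesis `hq` of `LevelE.theoremA_contradiction_schema`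
  (`X^(2e) ∣ X^ε·U·X^(e+a)·pair k1 cy`);
* §4 the cup-product forms `inv_q(loc_q(x ∪_B y)) = 0` / `inv_q(loc_q(φ_* x ∪_B y)) = 0` (tree
  `localTerm_pairingDual`), incl. the `…_of_terms` variant (terms on `S` as hypotheses) and the
  dischargers `…_of_localization_{left,right}_eq_zero`.

NOT done here: the choice of `q` (STEP 2, x9), `κ_q` (G3), `y` (G1), the value of the term at `q`
(Lemma 1 (iii), koly S4.3), the instantiation to `𝒯_J(E, κ) × 𝒯_J(E, κ⁻¹) → μ_p` over `ℚ` (sequel).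
References: MU-TRANSFER-PROOF §5 STEP 4, (F7); J. S. Milne, *Arithmetic Duality Theorems* (2006),
I Thm. 4.10 (b), Thm. 2.6, Rem. 3.7 [MilneADT2006]; J.-P. Serre, *Galois Cohomology* (1997), I §2.4
[SerreGaloisCohomology1997]; B. Mazur, K. Rubin, Mem. AMS 799 (2004), Thm. 2.3.4 [MazurRubin2004].
-/

-- the summit and its single problem are both named `BirchSwinnertonDyer` (registry layout D-0017)
set_option linter.dupNamespace false

set_option autoImplicit false

noncomputable section

open scoped ContRepresentation
open Function NumberField IsDedekindDomain Field
open scoped NumberField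
open Literature.NumberTheory.GaloisRepresentations
open Literature.NumberTheory.GaloisRepresentations.DiscreteGaloisModule (mu MuCarrier pairing TateDual
  tateDual pairingDualIntertwining)
open Literature.NumberTheory.GaloisCohomology
open Summit.BirchSwinnertonDyer.Rank1Residual.GaloisImage

universe u

namespace Summit.BirchSwinnertonDyer.BirchSwinnertonDyer.Rank1Residual.StepFour


variable {K : Type u} [Field K] [NumberField K]
variable {M : Type u} [AddCommGroup M] [TopologicalSpace M] [DiscreteTopology M] [Finite M]
variable {n : ℕ}

/-! ### §1 The three local vanishings -/

omit [Finite M] in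
/-- **At an infinite place every localisation of an `n`-torsion class vanishes when `n` is odd**
(`H¹(K_w, M)` is killed by `2` and by `n`). MU-TRANSFER-PROOF §5 STEP 4: «`v = ∞`: nothing, `p` odd».
[cite: SerreGaloisCohomology1997, I §2.4] -/
theorem localization_inl_eq_zero_of_odd (ρ : DiscreteGaloisModule K M) (hn : Odd n)
    (hM : ∀ m : M, n • m = 0) (w : InfinitePlace K) (x : galoisCohomology ρ 1) :
    galoisCohomology.localization ρ (Sum.inl w) 1 x = 0 :=
  eq_zero_of_odd_nsmul_galoisCohomology_one_toLocal_inl ρ w hn _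
    (by rw [← map_nsmul, galoisCohomology.nsmul_eq_zero_of_forall ρ hM x, map_zero])

/-- **The local term at an infinite place vanishes at odd level** (any `inv_w`). [cite: MilneADT2006, Ch. I, Rem. 3.7] -/
theorem localTerm_inl_eq_zero_of_odd (inv : LocalInvariants K n) (ρ : DiscreteGaloisModule K M)
    (hn : Odd n) (hM : ∀ m : M, n • m = 0) (w : InfinitePlace K) (x : galoisCohomology ρ 1)
    (y : galoisCohomology (ρ.tateDual n) 1) : inv.localTerm ρ (Sum.inl w) x y = 0 := by
  rw [LocalInvariants.localTerm_apply, localization_inl_eq_zero_of_odd ρ hn hM w x, map_zero,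
    AddMonoidHom.zero_apply, map_zero]

/-- A local term whose LEFT localisation vanishes is zero. [folklore] -/
theorem localTerm_eq_zero_of_localization_left_eq_zero (inv : LocalInvariants K n)
    (ρ : DiscreteGaloisModule K M) (v : Place K) {x : galoisCohomology ρ 1}
    (hx : galoisCohomology.localization ρ v 1 x = 0) (y : galoisCohomology (ρ.tateDual n) 1) :
    inv.localTerm ρ v x y = 0 := by
  rw [LocalInvariants.localTerm_apply, hx, map_zero, AddMonoidHom.zero_apply, map_zero]

/-- A local term whose RIGHT localisation vanishes is zero (STEP 1 / G1's shape on `S`). [folklore] -/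
theorem localTerm_eq_zero_of_localization_right_eq_zero (inv : LocalInvariants K n)
    (ρ : DiscreteGaloisModule K M) (v : Place K) (x : galoisCohomology ρ 1)
    {y : galoisCohomology (ρ.tateDual n) 1}
    (hy : galoisCohomology.localization (ρ.tateDual n) v 1 y = 0) : inv.localTerm ρ v x y = 0 := by
  rw [LocalInvariants.localTerm_apply, hy, map_zero, map_zero]

/-- **At a finite place where inertia fixes `M` and `M^D`, two unramified localisations have local term
zero, for EVERY additive `inv_v`** (Milne I Thm. 2.6; team n1011's kernel theorem
`UnramifiedCup.localTatePairingZMod_eq_zero_of_mem_unramifiedSubgroup`). [cite: MilneADT2006, Ch. I, Thm. 2.6] -/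
theorem localTerm_inr_eq_zero_of_mem_unramifiedSubgroup [NeZero n] (inv : LocalInvariants K n)
    (ρ : DiscreteGaloisModule K M) (v : HeightOneSpectrum (𝓞 K))
    (hI : ∀ t ∈ absInertia (v.adicCompletion K), ∀ m : M, GaloisRep.toLocal v ρ t m = m)
    (hID : ∀ t ∈ absInertia (v.adicCompletion K), ∀ f : TateDual K M n,
      GaloisRep.toLocal v (ρ.tateDual n) t f = f)
    {x : galoisCohomology ρ 1} {y : galoisCohomology (ρ.tateDual n) 1}
    (hx : galoisCohomology.localization ρ (Sum.inr v) 1 x ∈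
      DiscreteGaloisModule.unramifiedSubgroup (GaloisRep.toLocal v ρ) 1)
    (hy : galoisCohomology.localization (ρ.tateDual n) (Sum.inr v) 1 y ∈
      DiscreteGaloisModule.unramifiedSubgroup (GaloisRep.toLocal v (ρ.tateDual n)) 1) :
    inv.localTerm ρ (Sum.inr v) x y = 0 := by
  rw [LocalInvariants.localTerm_apply, ← DiscreteGaloisModule.localTatePairingZMod_apply]
  exact UnramifiedCup.localTatePairingZMod_eq_zero_of_mem_unramifiedSubgroup ρ n v hI hID _ hx hy

/-! ### §2 The local term at the auxiliary prime vanishes -/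

/-- **MU-TRANSFER-PROOF §5 STEP 4 (reciprocity), generic form.** `n` ODD, `M` a finite discrete
`Γ_K`-module killed by `n`, `inv` a family of local invariant maps with the Poitou–Tate vanishing
(`LocalInvariants.SumLocalTermEqZero` — the content of the tree's named fact
`poitouTate_sum_localTatePairing_eq_zero K`, Milne I Thm. 4.10 (b)), `S` finite places, `q` a finite
place. If `x ∈ H¹(K, M)`, `y ∈ H¹(K, M^D)` have UNRAMIFIED localisations at every finite `v ∉ S`,
`v ≠ q` at which inertia fixes `M` and `M^D`, and the local terms vanish on `S`, then **the local term
at `q` vanishes** — the terms vanish at the infinite places (`n` odd), off `S ∪ {q}` (unramified), on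
`S` (hypothesis), and no single place can carry a non-zero term. [cite: MilneADT2006, Ch. I, Thm. 4.10(b)] -/
theorem localTerm_inr_eq_zero_of_unramified_outside [NeZero n] (hn : Odd n)
    {inv : LocalInvariants K n} (hPT : inv.SumLocalTermEqZero) (ρ : DiscreteGaloisModule K M)
    (hM : ∀ m : M, n • m = 0) (S : Finset (HeightOneSpectrum (𝓞 K))) (q : HeightOneSpectrum (𝓞 K))
    (x : galoisCohomology ρ 1) (y : galoisCohomology (ρ.tateDual n) 1)
    (hI : ∀ v ∉ S, v ≠ q → ∀ t ∈ absInertia (v.adicCompletion K), ∀ m : M,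
      GaloisRep.toLocal v ρ t m = m)
    (hID : ∀ v ∉ S, v ≠ q → ∀ t ∈ absInertia (v.adicCompletion K), ∀ f : TateDual K M n,
      GaloisRep.toLocal v (ρ.tateDual n) t f = f)
    (hx : ∀ v ∉ S, v ≠ q → galoisCohomology.localization ρ (Sum.inr v) 1 x ∈
      DiscreteGaloisModule.unramifiedSubgroup (GaloisRep.toLocal v ρ) 1)
    (hy : ∀ v ∉ S, v ≠ q → galoisCohomology.localization (ρ.tateDual n) (Sum.inr v) 1 y ∈
      DiscreteGaloisModule.unramifiedSubgroup (GaloisRep.toLocal v (ρ.tateDual n)) 1)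
    (hS : ∀ v ∈ S, inv.localTerm ρ (Sum.inr v) x y = 0) :
    inv.localTerm ρ (Sum.inr q) x y = 0 := by
  refine hPT.localTerm_eq_zero ρ hM x y (Sum.inr q) fun v hv => ?_
  rcases v with w | v
  · exact localTerm_inl_eq_zero_of_odd inv ρ hn hM w x y
  · by_cases hvS : v ∈ S
    · exact hS v hvS
    · have hvq : v ≠ q := fun h => hv (by rw [h])
      exact localTerm_inr_eq_zero_of_mem_unramifiedSubgroup inv ρ v (hI v hvS hvq) (hID v hvS hvq)
        (hx v hvS hvq) (hy v hvS hvq)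

/-- **STEP 4, generic form, with the inertia hypotheses read from `GaloisRep.IsUnramifiedAt`**: at a
finite `v ∤ n` at which `M` is unramified, inertia fixes `M` (`GaloisRep.isUnramifiedAt_iff_toLocal_holds`)
and `M^D` (`UnramifiedCup.toLocal_tateDual_apply_of_mem_absInertia_of_not_mem`, Serre LF IV §4).
[cite: MilneADT2006, Ch. I, Thm. 4.10(b)] -/
theorem localTerm_inr_eq_zero_of_unramified_outside_of_isUnramifiedAt [NeZero n] (hn : Odd n)
    {inv : LocalInvariants K n} (hPT : inv.SumLocalTermEqZero) (ρ : DiscreteGaloisModule K M)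
    (hM : ∀ m : M, n • m = 0) (S : Finset (HeightOneSpectrum (𝓞 K))) (q : HeightOneSpectrum (𝓞 K))
    (x : galoisCohomology ρ 1) (y : galoisCohomology (ρ.tateDual n) 1)
    (hn' : ∀ v ∉ S, v ≠ q → ((n : ℕ) : 𝓞 K) ∉ v.asIdeal)
    (hur : ∀ v ∉ S, v ≠ q → GaloisRep.IsUnramifiedAt v ρ)
    (hx : ∀ v ∉ S, v ≠ q → galoisCohomology.localization ρ (Sum.inr v) 1 x ∈
      DiscreteGaloisModule.unramifiedSubgroup (GaloisRep.toLocal v ρ) 1)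
    (hy : ∀ v ∉ S, v ≠ q → galoisCohomology.localization (ρ.tateDual n) (Sum.inr v) 1 y ∈
      DiscreteGaloisModule.unramifiedSubgroup (GaloisRep.toLocal v (ρ.tateDual n)) 1)
    (hS : ∀ v ∈ S, inv.localTerm ρ (Sum.inr v) x y = 0) :
    inv.localTerm ρ (Sum.inr q) x y = 0 := by
  refine localTerm_inr_eq_zero_of_unramified_outside hn hPT ρ hM S q x y
    (fun v hvS hvq t ht m => ?_) (fun v hvS hvq t ht f => ?_) hx hy hS
  · have h := (GaloisRep.isUnramifiedAt_iff_toLocal_holds v ρ).1 (hur v hvS hvq) t ht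
    rw [h]
    rfl
  · exact UnramifiedCup.toLocal_tateDual_apply_of_mem_absInertia_of_not_mem ρ n v (hn' v hvS hvq)
      (hur v hvS hvq) ht f

/-! ### §3 The same for an arbitrary equivariant `μₙ`-valued pairing `B : M₁ × M₂ → μₙ` -/

section Pairing

variable {M₂ : Type u} [AddCommGroup M₂] [TopologicalSpace M₂] [DiscreteTopology M₂]
variable {ρ₁ : DiscreteGaloisModule K M} {ρ₂ : DiscreteGaloisModule K M₂}
variable {B : M →+ M₂ →+ MuCarrier K n}
variable (hB : ∀ (σ : absoluteGaloisGroup K) (x : M) (y : M₂), B (ρ₁ σ x) (ρ₂ σ y) = mu K n σ (B x y))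

omit [Finite M] in
/-- **Equivariant maps preserve unramified localisations**: if `loc_v y` is unramified then so is
`loc_v (f_* y) = (f|_{Γ_{K_v}})_* (loc_v y)` (tree `galoisCohomology.res_map_one`; naturality of the
restriction to `K_v^{ur}`). [folklore] -/
theorem localization_map_mem_unramifiedSubgroup {N : Type u} [AddCommGroup N]
    [TopologicalSpace N] [DiscreteTopology N] {ρM : DiscreteGaloisModule K M}
    {ρN : DiscreteGaloisModule K N} (f : ρM.toContRepresentation →ⁱL ρN.toContRepresentation)
    (v : HeightOneSpectrum (𝓞 K)) {y : galoisCohomology ρM 1}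
    (hy : galoisCohomology.localization ρM (Sum.inr v) 1 y ∈
      DiscreteGaloisModule.unramifiedSubgroup (GaloisRep.toLocal v ρM) 1) :
    galoisCohomology.localization ρN (Sum.inr v) 1 (galoisCohomology.map f 1 y) ∈
      DiscreteGaloisModule.unramifiedSubgroup (GaloisRep.toLocal v ρN) 1 := by
  -- `H¹_ur = ker (res to K_v^{ur})`; both memberships in the `restrictField` form, then naturality twice
  change galoisCohomology.res (GaloisRep.restrictField (v.adicCompletion K) ρN)
      (IsNonarchimedeanLocalField.maxUnramified (v.adicCompletion K)) 1
      (galoisCohomology.res ρN (v.adicCompletion K) 1 (galoisCohomology.map f 1 y)) = 0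
  change galoisCohomology.res (GaloisRep.restrictField (v.adicCompletion K) ρM)
      (IsNonarchimedeanLocalField.maxUnramified (v.adicCompletion K)) 1
      (galoisCohomology.res ρM (v.adicCompletion K) 1 y) = 0 at hy
  rw [galoisCohomology.res_map_one, galoisCohomology.res_map_one, hy]
  exact map_zero _

omit [Finite M] in
/-- Localisation commutes with the map induced by an equivariant map (tree `galoisCohomology.res_map_one`
at `K_v`). [folklore] -/
theorem localization_map_eq {N : Type u} [AddCommGroup N] [TopologicalSpace N]
    [DiscreteTopology N] {ρM : DiscreteGaloisModule K M} {ρN : DiscreteGaloisModule K N}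
    (f : ρM.toContRepresentation →ⁱL ρN.toContRepresentation) (v : Place K)
    (y : galoisCohomology ρM 1) :
    galoisCohomology.localization ρN v 1 (galoisCohomology.map f 1 y) =
      galoisCohomology.map (f.restrictField (Place.Completion v)) 1
        (galoisCohomology.localization ρM v 1 y) :=
  galoisCohomology.res_map_one (Place.Completion v) f y

include hB

/-- **MU-TRANSFER-PROOF §5 STEP 4 for an equivariant pairing `B : M₁ × M₂ → μₙ`** (local-term form; no
cup product in the statement). `n` odd, `M₁` finite killed by `n`, `inv` with the Poitou–Tate
vanishing, `S` finite places, `q` a finite place; `x ∈ H¹(K, M₁)`, `y ∈ H¹(K, M₂)` with unramified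
localisations at every finite `v ∉ S`, `v ≠ q` at which inertia fixes `M₁` and `M₁^D`, and
**`loc_v y = 0` for `v ∈ S`** — the shape in which STEP 1 / G1 delivers them (`T^ε·loc_v y = 0`, i.e.
`loc_v (T^ε y) = 0`; pair `κ_q` with `T^ε y`). Then the local term at `q` of `(x, (B^♭)_* y)`
vanishes: **`⟨x_q, ((B^♭)_* y)_q⟩_q = 0`**, i.e. `inv_q(loc_q(x ∪_B y)) = 0` (tree
`localTerm_pairingDual`; cup-product form `inv_localization_cupProduct_pairing_eq_zero_of_unramified_outside`).
`(B^♭)_* y` is unramified where `y` is (`localization_map_mem_unramifiedSubgroup`).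
[cite: MilneADT2006, Ch. I, Thm. 4.10(b)] -/
theorem localTerm_pairingDual_eq_zero_of_unramified_outside [NeZero n] (hn : Odd n)
    {inv : LocalInvariants K n} (hPT : inv.SumLocalTermEqZero) (hM : ∀ m : M, n • m = 0)
    (S : Finset (HeightOneSpectrum (𝓞 K))) (q : HeightOneSpectrum (𝓞 K))
    (x : galoisCohomology ρ₁ 1) (y : galoisCohomology ρ₂ 1)
    (hI : ∀ v ∉ S, v ≠ q → ∀ t ∈ absInertia (v.adicCompletion K), ∀ m : M,
      GaloisRep.toLocal v ρ₁ t m = m)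
    (hID : ∀ v ∉ S, v ≠ q → ∀ t ∈ absInertia (v.adicCompletion K), ∀ f : TateDual K M n,
      GaloisRep.toLocal v (ρ₁.tateDual n) t f = f)
    (hx : ∀ v ∉ S, v ≠ q → galoisCohomology.localization ρ₁ (Sum.inr v) 1 x ∈
      DiscreteGaloisModule.unramifiedSubgroup (GaloisRep.toLocal v ρ₁) 1)
    (hy : ∀ v ∉ S, v ≠ q → galoisCohomology.localization ρ₂ (Sum.inr v) 1 y ∈
      DiscreteGaloisModule.unramifiedSubgroup (GaloisRep.toLocal v ρ₂) 1)
    (hS : ∀ v ∈ S, galoisCohomology.localization ρ₂ (Sum.inr v) 1 y = 0) :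
    inv.localTerm ρ₁ (Sum.inr q) x (galoisCohomology.map (pairingDualIntertwining hB) 1 y) = 0 := by
  refine localTerm_inr_eq_zero_of_unramified_outside hn hPT ρ₁ hM S q x _ hI hID hx
    (fun v hvS hvq => localization_map_mem_unramifiedSubgroup _ v (hy v hvS hvq)) fun v hvS => ?_
  refine localTerm_eq_zero_of_localization_right_eq_zero inv ρ₁ (Sum.inr v) x ?_
  rw [localization_map_eq, hS v hvS]
  exact map_zero _

/-- **STEP 4, family form (local-term form).** Under the hypotheses of
`localTerm_pairingDual_eq_zero_of_unramified_outside` on `(x, y)`, for EVERY `Γ_K`-equivariant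
endomorphism `φ` of `M₁` the pair `(φ_* x, y)` has vanishing term at `q` (`φ_* x` is unramified
wherever `x` is); with `M₁ = 𝒯_J(E, κ)`, `φ = S^{J−1−k}` these are the members
`Φ_k = inv_q(S^{J−1−k}_* κ_q ∪ T^ε ψ)` of the coefficient family of MU-TRANSFER-PROOF (F7) — all zero.
[cite: MilneADT2006, Ch. I, Thm. 4.10(b)] -/
theorem localTerm_map_pairingDual_eq_zero_of_unramified_outside [NeZero n] (hn : Odd n)
    {inv : LocalInvariants K n} (hPT : inv.SumLocalTermEqZero) (hM : ∀ m : M, n • m = 0)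
    (S : Finset (HeightOneSpectrum (𝓞 K))) (q : HeightOneSpectrum (𝓞 K))
    (x : galoisCohomology ρ₁ 1) (y : galoisCohomology ρ₂ 1)
    (hI : ∀ v ∉ S, v ≠ q → ∀ t ∈ absInertia (v.adicCompletion K), ∀ m : M,
      GaloisRep.toLocal v ρ₁ t m = m)
    (hID : ∀ v ∉ S, v ≠ q → ∀ t ∈ absInertia (v.adicCompletion K), ∀ f : TateDual K M n,
      GaloisRep.toLocal v (ρ₁.tateDual n) t f = f)
    (hx : ∀ v ∉ S, v ≠ q → galoisCohomology.localization ρ₁ (Sum.inr v) 1 x ∈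
      DiscreteGaloisModule.unramifiedSubgroup (GaloisRep.toLocal v ρ₁) 1)
    (hy : ∀ v ∉ S, v ≠ q → galoisCohomology.localization ρ₂ (Sum.inr v) 1 y ∈
      DiscreteGaloisModule.unramifiedSubgroup (GaloisRep.toLocal v ρ₂) 1)
    (hS : ∀ v ∈ S, galoisCohomology.localization ρ₂ (Sum.inr v) 1 y = 0)
    (φ : ρ₁.toContRepresentation →ⁱL ρ₁.toContRepresentation) :
    inv.localTerm ρ₁ (Sum.inr q) (galoisCohomology.map φ 1 x)
      (galoisCohomology.map (pairingDualIntertwining hB) 1 y) = 0 :=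
  localTerm_pairingDual_eq_zero_of_unramified_outside hB hn hPT hM S q _ y hI hID
    (fun v hvS hvq => localization_map_mem_unramifiedSubgroup φ v (hx v hvS hvq)) hy hS

/-! ### §4 Cup-product forms (`Γ_K` locally compact: `absoluteGaloisGroup_compactSpace K`, a `Prop`) -/

variable [LocallyCompactSpace (absoluteGaloisGroup K)]

/-- The term `inv_v(loc_v(x ∪_B y))` vanishes when `loc_v x = 0` (tree `localTerm_pairingDual`). [folklore] -/
theorem inv_localization_cupProduct_pairing_eq_zero_of_localization_left_eq_zero
    (inv : LocalInvariants K n) (v : Place K) {x : galoisCohomology ρ₁ 1}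
    (hx : galoisCohomology.localization ρ₁ v 1 x = 0) (y : galoisCohomology ρ₂ 1) :
    inv v (galoisCohomology.localization (mu K n) v 2
      ((pairing ρ₁ ρ₂ (mu K n) B hB).cupProduct x y)) = 0 := by
  rw [← DiscreteGaloisModule.localTerm_pairingDual hB]
  exact localTerm_eq_zero_of_localization_left_eq_zero inv ρ₁ v hx _

/-- The term `inv_v(loc_v(x ∪_B y))` vanishes when `loc_v y = 0`. [folklore] -/
theorem inv_localization_cupProduct_pairing_eq_zero_of_localization_right_eq_zero
    (inv : LocalInvariants K n) (v : Place K) (x : galoisCohomology ρ₁ 1)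
    {y : galoisCohomology ρ₂ 1} (hy : galoisCohomology.localization ρ₂ v 1 y = 0) :
    inv v (galoisCohomology.localization (mu K n) v 2
      ((pairing ρ₁ ρ₂ (mu K n) B hB).cupProduct x y)) = 0 := by
  rw [← DiscreteGaloisModule.localTerm_pairingDual hB]
  refine localTerm_eq_zero_of_localization_right_eq_zero inv ρ₁ v x ?_
  rw [localization_map_eq, hy]
  exact map_zero _

/-- **MU-TRANSFER-PROOF §5 STEP 4, cup-product form, the terms on `S` as hypotheses**: `x`, `y`
unramified at every finite `v ∉ S`, `v ≠ q` at which inertia fixes `M₁` and `M₁^D`, and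
`inv_v(loc_v(x ∪_B y)) = 0` for `v ∈ S` ⟹ **`inv_q(loc_q(x ∪_B y)) = 0`**.
[cite: MilneADT2006, Ch. I, Thm. 4.10(b)] -/
theorem inv_localization_cupProduct_pairing_eq_zero_of_unramified_outside_of_terms [NeZero n]
    (hn : Odd n) {inv : LocalInvariants K n} (hPT : inv.SumLocalTermEqZero) (hM : ∀ m : M, n • m = 0)
    (S : Finset (HeightOneSpectrum (𝓞 K))) (q : HeightOneSpectrum (𝓞 K))
    (x : galoisCohomology ρ₁ 1) (y : galoisCohomology ρ₂ 1)
    (hI : ∀ v ∉ S, v ≠ q → ∀ t ∈ absInertia (v.adicCompletion K), ∀ m : M,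
      GaloisRep.toLocal v ρ₁ t m = m)
    (hID : ∀ v ∉ S, v ≠ q → ∀ t ∈ absInertia (v.adicCompletion K), ∀ f : TateDual K M n,
      GaloisRep.toLocal v (ρ₁.tateDual n) t f = f)
    (hx : ∀ v ∉ S, v ≠ q → galoisCohomology.localization ρ₁ (Sum.inr v) 1 x ∈
      DiscreteGaloisModule.unramifiedSubgroup (GaloisRep.toLocal v ρ₁) 1)
    (hy : ∀ v ∉ S, v ≠ q → galoisCohomology.localization ρ₂ (Sum.inr v) 1 y ∈
      DiscreteGaloisModule.unramifiedSubgroup (GaloisRep.toLocal v ρ₂) 1)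
    (hS : ∀ v ∈ S, inv (Sum.inr v) (galoisCohomology.localization (mu K n) (Sum.inr v) 2
      ((pairing ρ₁ ρ₂ (mu K n) B hB).cupProduct x y)) = 0) :
    inv (Sum.inr q) (galoisCohomology.localization (mu K n) (Sum.inr q) 2
      ((pairing ρ₁ ρ₂ (mu K n) B hB).cupProduct x y)) = 0 := by
  rw [← DiscreteGaloisModule.localTerm_pairingDual hB]
  refine localTerm_inr_eq_zero_of_unramified_outside hn hPT ρ₁ hM S q x _ hI hID hx
    (fun v hvS hvq => localization_map_mem_unramifiedSubgroup _ v (hy v hvS hvq)) fun v hvS => ?_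
  rw [DiscreteGaloisModule.localTerm_pairingDual hB]
  exact hS v hvS

/-- **MU-TRANSFER-PROOF §5 STEP 4, cup-product form**, the places `v ∈ S` discharged by `loc_v y = 0`:
**`inv_q(loc_q(x ∪_B y)) = 0`**. [cite: MilneADT2006, Ch. I, Thm. 4.10(b)] -/
theorem inv_localization_cupProduct_pairing_eq_zero_of_unramified_outside [NeZero n] (hn : Odd n)
    {inv : LocalInvariants K n} (hPT : inv.SumLocalTermEqZero) (hM : ∀ m : M, n • m = 0)
    (S : Finset (HeightOneSpectrum (𝓞 K))) (q : HeightOneSpectrum (𝓞 K))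
    (x : galoisCohomology ρ₁ 1) (y : galoisCohomology ρ₂ 1)
    (hI : ∀ v ∉ S, v ≠ q → ∀ t ∈ absInertia (v.adicCompletion K), ∀ m : M,
      GaloisRep.toLocal v ρ₁ t m = m)
    (hID : ∀ v ∉ S, v ≠ q → ∀ t ∈ absInertia (v.adicCompletion K), ∀ f : TateDual K M n,
      GaloisRep.toLocal v (ρ₁.tateDual n) t f = f)
    (hx : ∀ v ∉ S, v ≠ q → galoisCohomology.localization ρ₁ (Sum.inr v) 1 x ∈
      DiscreteGaloisModule.unramifiedSubgroup (GaloisRep.toLocal v ρ₁) 1)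
    (hy : ∀ v ∉ S, v ≠ q → galoisCohomology.localization ρ₂ (Sum.inr v) 1 y ∈
      DiscreteGaloisModule.unramifiedSubgroup (GaloisRep.toLocal v ρ₂) 1)
    (hS : ∀ v ∈ S, galoisCohomology.localization ρ₂ (Sum.inr v) 1 y = 0) :
    inv (Sum.inr q) (galoisCohomology.localization (mu K n) (Sum.inr q) 2
      ((pairing ρ₁ ρ₂ (mu K n) B hB).cupProduct x y)) = 0 := by
  rw [← DiscreteGaloisModule.localTerm_pairingDual hB]
  exact localTerm_pairingDual_eq_zero_of_unramified_outside hB hn hPT hM S q x y hI hID hx hy hS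

/-- **STEP 4, family form, cup-product form**: **`inv_q(loc_q(φ_* x ∪_B y)) = 0`** for every
`Γ_K`-equivariant endomorphism `φ` of `M₁` (the assembler's coefficient family `Φ_k`, `φ = S^{J−1−k}`).
[cite: MilneADT2006, Ch. I, Thm. 4.10(b)] -/
theorem inv_localization_cupProduct_pairing_map_eq_zero_of_unramified_outside [NeZero n] (hn : Odd n)
    {inv : LocalInvariants K n} (hPT : inv.SumLocalTermEqZero) (hM : ∀ m : M, n • m = 0)
    (S : Finset (HeightOneSpectrum (𝓞 K))) (q : HeightOneSpectrum (𝓞 K))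
    (x : galoisCohomology ρ₁ 1) (y : galoisCohomology ρ₂ 1)
    (hI : ∀ v ∉ S, v ≠ q → ∀ t ∈ absInertia (v.adicCompletion K), ∀ m : M,
      GaloisRep.toLocal v ρ₁ t m = m)
    (hID : ∀ v ∉ S, v ≠ q → ∀ t ∈ absInertia (v.adicCompletion K), ∀ f : TateDual K M n,
      GaloisRep.toLocal v (ρ₁.tateDual n) t f = f)
    (hx : ∀ v ∉ S, v ≠ q → galoisCohomology.localization ρ₁ (Sum.inr v) 1 x ∈
      DiscreteGaloisModule.unramifiedSubgroup (GaloisRep.toLocal v ρ₁) 1)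
    (hy : ∀ v ∉ S, v ≠ q → galoisCohomology.localization ρ₂ (Sum.inr v) 1 y ∈
      DiscreteGaloisModule.unramifiedSubgroup (GaloisRep.toLocal v ρ₂) 1)
    (hS : ∀ v ∈ S, galoisCohomology.localization ρ₂ (Sum.inr v) 1 y = 0)
    (φ : ρ₁.toContRepresentation →ⁱL ρ₁.toContRepresentation) :
    inv (Sum.inr q) (galoisCohomology.localization (mu K n) (Sum.inr q) 2
      ((pairing ρ₁ ρ₂ (mu K n) B hB).cupProduct (galoisCohomology.map φ 1 x) y)) = 0 :=
  inv_localization_cupProduct_pairing_eq_zero_of_unramified_outside hB hn hPT hM S q _ y hI hID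
    (fun v hvS hvq => localization_map_mem_unramifiedSubgroup φ v (hx v hvS hvq)) hy hS

end Pairing

end Summit.BirchSwinnertonDyer.BirchSwinnertonDyer.Rank1Residual.StepFour

end
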